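import Mathlib.Data.ZMod.Basic
import Mathlib.Data.Fin.VecNotation
import Mathlib.Algebra.Group.End
import Literature.Combinatorics.Additive.TripleProductProperty
import Literature.Computability.AlgebraicComplexity.CohnUmansTPP
import HarnessLib

/-!
# Cohn–Umans 2003, Prop. 7.4: the Frobenius group `C₅ ⋉ 𝔽₁₆` of order `80` realizes `⟨5, 5, 8⟩`

Topic `Literature/Computability/AlgebraicComplexity` (group-theoretic matrix multiplication), namespace
`Literature.Computability.AlgebraicComplexity.Frobenius80`.

H. Cohn, C. Umans, *A group-theoretic approach to fast matrix multiplication*, FOCS 2003 = arXiv:math/0307321, §7.1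
(Proposition 16 of the arXiv text, pp. 9–10): "Let `C₅ ⊂ 𝔽₁₆^×` be the unique subgroup of order `5`. Consider its
semidirect product `G = C₅ ⋉ 𝔽₁₆` with the additive group of `𝔽₁₆`, where multiplication is defined by
`(α,x)(β,y) = (αβ, βx + y)`. **Proposition 7.4.** The group `G = C₅ ⋉ 𝔽₁₆` realizes `⟨5, 5, 8⟩`, and thus
`α(G) ≤ 3 log_{200} 80 = 2.4811…`. *Proof.* Let `H₁ = {(α,0) : α ∈ C₅}` and `H₂ = {(α, α−1) : α ∈ C₅}` (i.e., `H₂` is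
`H₁` conjugated by `(1,1)`). Let `H₃ = {(1,x) : x ∈ 𝔽₁₆, Tr x = 0}`, where Tr denotes the trace from `𝔽₁₆` to `𝔽₂`.
These groups satisfy `|H₁| = |H₂| = 5` and `|H₃| = 8`. All we need to check is the triple product property. …"
(Aschbacher's trace argument follows; "`2.4811…` … is the best pseudo-exponent attained using three subgroups in any
group of order up to `100`".)

## Lean rendering (a finite model; the TPP check is a `decide` certificate in place of the trace argument)
`𝔽₁₆⁺ = 𝔽₂⁴` in the basis `1, ζ, ζ², ζ³` of a primitive 5th root of unity `ζ` (`ζ⁴ = ζ³+ζ²+ζ+1`), multiplication by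
`ζ` = the linear map `mulζ (a,b,c,d) = (d, a+d, b+d, c+d)` of order `5`; `G` = the affine maps `x ↦ ζᵏx + c`
(`Aff`, `k ∈ ℤ/5`, `c ∈ 𝔽₂⁴`; `|G| = 80`, `card_aff`) — isomorphic to the printed `C₅ ⋉ 𝔽₁₆`; `H₁` = `{x ↦ ζᵏx}`
(`rotHom`), `H₂` = its conjugate by the translation by `1` (`crotHom`), `H₃` = translations by trace-zero vectors
(`Tr(a + bζ + cζ² + dζ³) = b + c + d`; `transHom` on the hyperplane `W`). `CohnUmans2003_prop74 : RealizesTPP Aff 5 5 8`.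
The value `3 log 80 / log 200` is arithmetic and not restated.

## References
* H. Cohn, C. Umans, FOCS 2003, 438–449; arXiv:math/0307321, §7.1, Prop. 7.4 (Prop. 16 of the arXiv text, pp. 9–10).
  [CohnUmans2003]
-/

namespace Literature.Computability.AlgebraicComplexity

namespace Frobenius80

open Finset Literature.Combinatorics.Additive

/-- `𝔽₁₆` as an `𝔽₂`-vector space in the basis `1, ζ, ζ², ζ³`. [cite: CohnUmans2003, Prop. 7.4 (setting)] -/
abbrev V : Type := Fin 4 → ZMod 2

/-- Multiplication by `ζ` (`ζ⁴ = ζ³ + ζ² + ζ + 1`): `(a,b,c,d) ↦ (d, a+d, b+d, c+d)`. [cite: CohnUmans2003, Prop. 7.4 (setting)] -/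
def mulζ (x : V) : V := ![x 3, x 0 + x 3, x 1 + x 3, x 2 + x 3]

/-- `mulζ` is additive. [cite: CohnUmans2003, Prop. 7.4 (setting)] -/
theorem mulζ_add (x y : V) : mulζ (x + y) = mulζ x + mulζ y := by
  ext i; fin_cases i <;> simp [mulζ] <;> ring

/-- `mulζ 0 = 0`. [cite: CohnUmans2003, Prop. 7.4 (setting)] -/
theorem mulζ_zero : mulζ 0 = 0 := by
  ext i; fin_cases i <;> simp [mulζ]

/-- `ζ⁵ = 1`: `mulζ` has order dividing `5`. [cite: CohnUmans2003, Prop. 7.4 ("the unique subgroup of order 5")] -/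
theorem mulζ_iterate_five : mulζ^[5] = id := by
  funext x
  simp only [Function.iterate_succ, Function.iterate_zero, Function.comp_apply, id]
  revert x
  decide +kernel

/-- The action `k ↦ ζᵏ` of `ℤ/5` on `𝔽₂⁴`. [cite: CohnUmans2003, Prop. 7.4 (setting)] -/
def act (k : ZMod 5) : V → V := mulζ^[k.val]

/-- `ζ⁵ = 1` makes the exponent matter only modulo `5`. [cite: CohnUmans2003, Prop. 7.4 (setting)] -/
theorem iterate_mod_five (n : ℕ) : mulζ^[n % 5] = mulζ^[n] := by
  conv_rhs => rw [← Nat.mod_add_div n 5]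
  rw [Function.iterate_add, Function.iterate_mul, mulζ_iterate_five, Function.iterate_id, Function.comp_id]

/-- `ζᵃ⁺ᵇ = ζᵃ ∘ ζᵇ`. [cite: CohnUmans2003, Prop. 7.4 (setting)] -/
theorem act_add (a b : ZMod 5) : act (a + b) = act a ∘ act b := by
  unfold act
  rw [ZMod.val_add, iterate_mod_five, Function.iterate_add]

/-- `ζⁿ` is additive. [cite: CohnUmans2003, Prop. 7.4 (setting)] -/
theorem iterate_map_add (n : ℕ) (x y : V) : mulζ^[n] (x + y) = mulζ^[n] x + mulζ^[n] y := by
  induction n with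
  | zero => simp
  | succ n ih => rw [Function.iterate_succ', Function.comp_apply, ih, mulζ_add]; rfl

/-- `ζᵏ` is additive. [cite: CohnUmans2003, Prop. 7.4 (setting)] -/
theorem act_map_add (k : ZMod 5) (x y : V) : act k (x + y) = act k x + act k y :=
  iterate_map_add k.val x y

/-- `ζᵏ 0 = 0`. [cite: CohnUmans2003, Prop. 7.4 (setting)] -/
theorem act_zero_vec (k : ZMod 5) : act k 0 = 0 := by
  have h := act_map_add k 0 0
  rw [add_zero] at h
  have h2 : act k 0 + act k 0 = act k 0 + 0 := by rw [← h, add_zero]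
  exact add_left_cancel h2

/-- `ζᵏ (−x) = −ζᵏ x`. [cite: CohnUmans2003, Prop. 7.4 (setting)] -/
theorem act_neg (k : ZMod 5) (x : V) : act k (-x) = -act k x := by
  have h := act_map_add k x (-x)
  rw [add_neg_cancel, act_zero_vec] at h
  exact (neg_eq_of_add_eq_zero_right h.symm).symm

/-- The group `G = C₅ ⋉ 𝔽₁₆` as affine maps `x ↦ ζᵏx + c`. [cite: CohnUmans2003, Prop. 7.4 ("G = C₅ ⋉ 𝔽₁₆")] -/
@[ext]
structure Aff where
  /-- the rotation exponent `k` (`α = ζᵏ`) -/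
  k : ZMod 5
  /-- the translation part `c` -/
  c : V
deriving DecidableEq

namespace Aff

/-- Composition of affine maps: `(x ↦ ζᵏx + c) ∘ (x ↦ ζˡx + d) = x ↦ ζᵏ⁺ˡx + (ζᵏd + c)`.
[cite: CohnUmans2003, Prop. 7.4 ("(α,x)(β,y) = (αβ, βx + y)", up to the side of the action)] -/
instance : Mul Aff where mul g h := ⟨g.k + h.k, act g.k h.c + g.c⟩
/-- The identity map. [folklore] -/
instance : One Aff where one := ⟨0, 0⟩
/-- The inverse affine map `x ↦ ζ⁻ᵏx − ζ⁻ᵏc`. [folklore] -/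
instance : Inv Aff where inv g := ⟨-g.k, -act (-g.k) g.c⟩

/-- Component formula. [cite: CohnUmans2003, Prop. 7.4 (group law)] -/
@[simp] theorem mul_k (g h : Aff) : (g * h).k = g.k + h.k := rfl
/-- Component formula. [cite: CohnUmans2003, Prop. 7.4 (group law)] -/
@[simp] theorem mul_c (g h : Aff) : (g * h).c = act g.k h.c + g.c := rfl
/-- Component formula. [cite: CohnUmans2003, Prop. 7.4 (group law)] -/
@[simp] theorem one_k : (1 : Aff).k = 0 := rfl
/-- Component formula. [cite: CohnUmans2003, Prop. 7.4 (group law)] -/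
@[simp] theorem one_c : (1 : Aff).c = 0 := rfl
/-- Component formula. [cite: CohnUmans2003, Prop. 7.4 (group law)] -/
@[simp] theorem inv_k (g : Aff) : g⁻¹.k = -g.k := rfl
/-- Component formula. [cite: CohnUmans2003, Prop. 7.4 (group law)] -/
@[simp] theorem inv_c (g : Aff) : g⁻¹.c = -act (-g.k) g.c := rfl

/-- `G` is a group. [cite: CohnUmans2003, Prop. 7.4 ("G = C₅ ⋉ 𝔽₁₆")] -/
instance : Group Aff where
  mul_assoc g h m := by
    ext1
    · simp [add_assoc]
    · simp only [mul_c, mul_k, act_add, Function.comp_apply, act_map_add, add_assoc]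
  one_mul g := by
    ext1
    · simp
    · simp [act, ZMod.val_zero]
  mul_one g := by
    ext1
    · simp
    · simp [act_zero_vec]
  inv_mul_cancel g := by
    ext1
    · simp
    · simp only [mul_c, inv_k, inv_c, one_c]
      exact add_neg_cancel _

/-- `G ≃ ℤ/5 × 𝔽₂⁴`. [folklore] -/
def equivProd : Aff ≃ ZMod 5 × V where
  toFun g := (g.k, g.c)
  invFun p := ⟨p.1, p.2⟩
  left_inv _ := rfl
  right_inv _ := rfl

/-- Finiteness. [folklore] -/
instance : Fintype Aff := Fintype.ofEquiv _ equivProd.symm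

/-- `|G| = 80`. [cite: CohnUmans2003, Prop. 7.4 ("Frobenius group of order 80")] -/
theorem card_aff : Fintype.card Aff = 80 := by
  rw [Fintype.card_congr equivProd, Fintype.card_prod, ZMod.card]; rfl

end Aff

/-! ## The three subgroups -/

/-- `H₁ = {(α, 0)}`: the rotations `x ↦ ζᵏx`. [cite: CohnUmans2003, Prop. 7.4 (proof)] -/
def rotHom : Multiplicative (ZMod 5) →* Aff where
  toFun k := ⟨k.toAdd, 0⟩
  map_one' := rfl
  map_mul' a b := by ext1 <;> simp [act_zero_vec]

/-- The translation by `1 = (1,0,0,0)` (CU's element `(1,1)`). [cite: CohnUmans2003, Prop. 7.4 (proof)] -/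
def τ₁ : Aff := ⟨0, ![1, 0, 0, 0]⟩

/-- `H₂ = H₁` conjugated by `(1,1)`. [cite: CohnUmans2003, Prop. 7.4 (proof: "H₂ is H₁ conjugated by (1,1)")] -/
def crotHom : Multiplicative (ZMod 5) →* Aff := (MulAut.conj τ₁).toMonoidHom.comp rotHom

/-- The trace-zero hyperplane `W = {Tr = 0}`, `Tr(a + bζ + cζ² + dζ³) = b + c + d`.
[cite: CohnUmans2003, Prop. 7.4 (proof: "H₃ = {(1,x) : Tr x = 0}")] -/
def W : AddSubgroup V where
  carrier := {c | c 1 + c 2 + c 3 = 0}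
  zero_mem' := by simp
  add_mem' {a b} ha hb := by
    simp only [Set.mem_setOf_eq, Pi.add_apply] at ha hb ⊢
    linear_combination ha + hb
  neg_mem' {a} ha := by
    simp only [Set.mem_setOf_eq, Pi.neg_apply] at ha ⊢
    linear_combination -ha

/-- Membership in `W` is the decidable condition `c₁ + c₂ + c₃ = 0`. [folklore] -/
instance : DecidablePred (· ∈ W) := fun c => decEq (c 1 + c 2 + c 3) 0

/-- `H₃ = {(1, x) : Tr x = 0}`: translations by trace-zero vectors. [cite: CohnUmans2003, Prop. 7.4 (proof)] -/
def transHom : Multiplicative W →* Aff where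
  toFun w := ⟨0, (w.toAdd : V)⟩
  map_one' := rfl
  map_mul' a b := by
    ext1
    · simp
    · simp only [toAdd_mul, AddSubgroup.coe_add, Aff.mul_c, act, ZMod.val_zero, Function.iterate_zero, id]
      rw [add_comm]

/-- **The finite check behind Prop. 7.4** (subgroup form of the TPP, on coordinates): `(a,0)·(1,1)(b,0)(1,1)⁻¹ =
(0,w)` with `Tr w = 0` forces `a = b = 0`, `w = 0` (the paper proves this with `Tr(β − 1) = Tr β = 1` for
`β ∈ C₅ ∖ {1}`; here `decide` over the `5·5·16` triples). [cite: CohnUmans2003, Prop. 7.4 (proof; Prop. 16 of the arXiv text, pp. 9–10)] -/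
theorem criterion_plain : ∀ p : ZMod 5 × ZMod 5 × V, p.2.2 1 + p.2.2 2 + p.2.2 3 = 0 →
    ((⟨p.1, 0⟩ : Aff) * (τ₁ * ⟨p.2.1, 0⟩ * τ₁⁻¹)).k = 0 →
    ((⟨p.1, 0⟩ : Aff) * (τ₁ * ⟨p.2.1, 0⟩ * τ₁⁻¹)).c = p.2.2 → p.1 = 0 ∧ p.2.1 = 0 ∧ p.2.2 = 0 := by
  decide +kernel

/-- The same check for the three homomorphisms. [cite: CohnUmans2003, Prop. 7.4 (proof)] -/
theorem criterion (a b : Multiplicative (ZMod 5)) (w : Multiplicative W)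
    (h : rotHom a * crotHom b = transHom w) : a = 1 ∧ b = 1 ∧ w = 1 := by
  have h' : (⟨a.toAdd, 0⟩ : Aff) * (τ₁ * ⟨b.toAdd, 0⟩ * τ₁⁻¹) = ⟨0, (w.toAdd : V)⟩ := by
    simpa [rotHom, crotHom, transHom, MulAut.conj_apply] using h
  obtain ⟨h1, h2, h3⟩ := criterion_plain ⟨a.toAdd, b.toAdd, (w.toAdd : V)⟩ w.toAdd.2
    (by simpa using congrArg Aff.k h') (by simpa using congrArg Aff.c h')
  exact ⟨toAdd_eq_zero.1 h1, toAdd_eq_zero.1 h2, toAdd_eq_zero.1 (Subtype.ext h3)⟩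

/-- For subgroups (`Q(Hᵢ) = Hᵢ`) the tree's right-quotient TPP of three homomorphic images follows from the subgroup
form. [cite: CohnUmans2003, Def. 2.1 (remark after it)] -/
private theorem tpp_image_of_homs' {K₁ K₂ K₃ G : Type*} [Group K₁] [Group K₂] [Group K₃] [Group G]
    [Fintype K₁] [Fintype K₂] [Fintype K₃] [DecidableEq G] (φ₁ : K₁ →* G) (φ₂ : K₂ →* G) (φ₃ : K₃ →* G)
    (h : ∀ a b c, φ₁ a * φ₂ b = φ₃ c → a = 1 ∧ b = 1 ∧ c = 1) :
    TripleProductProperty (univ.image φ₁) (univ.image φ₂) (univ.image φ₃) := by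
  intro s hs s' hs' t ht t' ht' u hu u' hu' heq
  obtain ⟨a, -, rfl⟩ := mem_image.1 hs
  obtain ⟨a', -, rfl⟩ := mem_image.1 hs'
  obtain ⟨b, -, rfl⟩ := mem_image.1 ht
  obtain ⟨b', -, rfl⟩ := mem_image.1 ht'
  obtain ⟨c, -, rfl⟩ := mem_image.1 hu
  obtain ⟨c', -, rfl⟩ := mem_image.1 hu'
  have key : φ₁ (a * a'⁻¹) * φ₂ (b * b'⁻¹) = φ₃ (c' * c⁻¹) := by
    rw [map_mul, map_inv, map_mul, map_inv, map_mul, map_inv]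
    calc φ₁ a * (φ₁ a')⁻¹ * (φ₂ b * (φ₂ b')⁻¹)
        = φ₁ a * (φ₁ a')⁻¹ * (φ₂ b * (φ₂ b')⁻¹) * (φ₃ c * (φ₃ c')⁻¹) * (φ₃ c * (φ₃ c')⁻¹)⁻¹ := by group
      _ = φ₃ c' * (φ₃ c)⁻¹ := by rw [heq]; group
  obtain ⟨h1, h2, h3⟩ := h _ _ _ key
  exact ⟨by rw [mul_inv_eq_one.1 h1], by rw [mul_inv_eq_one.1 h2], by rw [mul_inv_eq_one.1 h3]⟩

/-- `|W| = 8` (so `|H₃| = 8`). [cite: CohnUmans2003, Prop. 7.4 (proof: "|H₃| = 8")] -/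
theorem card_W : Fintype.card W = 8 := by
  decide +kernel

/-- **Cohn–Umans 2003, Prop. 7.4**: `G = C₅ ⋉ 𝔽₁₆` (order `80`) realizes `⟨5, 5, 8⟩` through `H₁, H₂, H₃`.
[cite: CohnUmans2003, Prop. 7.4 (Prop. 16 of the arXiv text, pp. 9–10)] -/
theorem CohnUmans2003_prop74 : RealizesTPP Aff 5 5 8 := by
  have h1 : Function.Injective rotHom := fun a b h =>
    Multiplicative.toAdd.injective (by simpa [rotHom] using congrArg Aff.k h)
  have h2 : Function.Injective crotHom := fun a b h => h1 ((MulAut.conj τ₁).injective h)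
  have h3 : Function.Injective transHom := fun a b h =>
    Multiplicative.toAdd.injective (Subtype.ext (by simpa [transHom] using congrArg Aff.c h))
  refine ⟨univ.image rotHom, univ.image crotHom, univ.image transHom, ?_, ?_, ?_,
    tpp_image_of_homs' _ _ _ fun a b w h => criterion a b w h⟩
  · rw [card_image_of_injective _ h1, card_univ, Fintype.card_multiplicative, ZMod.card]
  · rw [card_image_of_injective _ h2, card_univ, Fintype.card_multiplicative, ZMod.card]
  · rw [card_image_of_injective _ h3, card_univ, Fintype.card_multiplicative, card_W]

end Frobenius80

end Literature.Computability.AlgebraicComplexity
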